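import Literature.MathematicalPhysics.QuantumLattice.HalfBathtubPairTableRows
import HarnessLib

/-!
# Kernel Fermi-sea floors at ANY `t'` from the four-corner half-bathtub table: `S + μ·n ≤ e(1, t', U, n)` for `|t'| > 1/2`

Family `hubbard` (topic `MathematicalPhysics/QuantumLattice`; companion of `HubbardFermiSeaCellRows` / `HubbardFermiSeaTangentRows*`
(kernel tangent rows, restricted to `|t'| ≤ 1/2` by the near-corner monotonicity of their cell sum) and of `HalfBathtubCornerBound` §9 /
`HalfBathtubPairTableRows` (hubbard-tc-p1: the FOUR-CORNER majorant of the half-bathtub integral `B(t', ν)`, valid at every `t'`).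
Written for the hubbard-tc cell (MO-S3, G3 competing-order back-end; seat `hubbard-tc-mod-3`, `prover-hubbard-tc-mod-3-g5-0`, 2026-08-27):
the electron-doped one-band columns of the S1 router (Sr₀.₉La₀.₁CuO₂, Nd₂₋ₓCeₓCuO₄, Nd₂CuO₄; object E `t'/t_eff ∈ [−0.65, −0.46]`) and their
particle–hole images (`t' ∈ [0.46, 0.65]`) sit OUTSIDE the `|t'| ≤ 1/2` reach of every kernel Fermi-sea row in the tree, so the G3 class
words there were certified-numerics only. This file removes that restriction WITHOUT a new cell-sum theorem, by Legendre duality with the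
stiffness side:

* §1 **The bridge** `energyDensityTT'_one_ge_affine_of_halfBathtub_le`: for every `τ, ν`, every `U ≥ 0` and every real `0 ≤ n < 2`,
  `−2ν·n − 4·B ≤ e(1, 2τ, U, n)` whenever `B(τ, ν) = (4π²)⁻¹∫_{−π}^{π}∫_{−π}^{π} (cos x + cos y + 4τ cos x cos y − ν)⁺ dx dy ≤ B`.
  Proof: the tree's bathtub floor `energyDensityTT'_ge_bathtub` (`μ n + 2(2π)⁻²∫_{[−π,π]²} min(ε(p) − μ, 0) dp ≤ e`, corner-shifted band
  `ε(p) = 2(cos p₁ + cos p₂) − 4t' cos p₁ cos p₂`) at `μ = −2ν`, `t' = 2τ`; pointwise `min(ε − μ, 0) = −2·(−cos p₁ − cos p₂ + 4τ cos p₁ cos p₂ − ν)⁺`;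
  the Brillouin-zone integral as an iterated interval integral (Fubini on the square; copies of the private helpers of
  `HubbardOneBodyKinematicRows` §3 / `HubbardSquareFreeFermionEnergyDensity` §4); and the half-period shift `x ↦ x + π` in each variable
  (`∫_{−π}^{π} g(−cos x) dx = ∫_{−π}^{π} g(cos x) dx`, periodicity), which turns `−cos` into `cos`. So a kernel UPPER bound on `B(t'/2, −μ/2)`
  is a kernel tangent row `S + μ·n ≤ e(1, t', U, n)` with `S = −4B`, at ANY `t'` — the free-gas floor and the kinematic stiffness bar are
  the two readings of one integral (`c_kin(t', n) = min_ν [ν n/2 + B(t', ν)]`, `e_free(t', n) ≥ −4·min_ν [ν n/2 + B(t'/2, ν)]`).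
* §2 **The integer adapter** `energyDensityTT'_one_ge_affine_of_cornerPairTable`: the hypotheses of
  `halfBathtub_le_of_cornerPairTable` verbatim (`τ = a/b`, `ν = c/E`, a pair table `P` with its two decidable checks, the four-corner integer
  sum `≤ W`, `W ≤ q·M²D²bE`) ⇒ `−2(c/E)·n − 4q ≤ e(1, 2a/b, U, n)`; rows below use hubbard-tc-p1's `M = 128` table `halfBathtubPairTable128`
  (`D = 2²⁰`, `E = 8192`; one `decide +kernel` of `128²` four-corner terms per row, as in `HalfBathtubPairTableRows*`).
* §3 **Rows** (tangent rows `S + μ·n ≤ e(1, t', U, n)`, `μ = −c/4096` optimal at the touch density `n₀` on the level grid `ℤ/8192`,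
  `S = −4·q`, `q` the upward `10⁻¹⁰`-rounding of the exact four-corner bound; generator `hubbard-tc-mod-3/g5-replay/fc_rows.py`, which calls
  p1's `corners4.py` on `(t'/2, n₀)`; listed per row docstring with the floor value at `n₀`).

HONEST SCOPE: one-body (`U = 0`) floors, first-order four-corner slack `≈ 2–4·10⁻³` (vs `≈ 1.5·10⁻³` for the `M = 64` cell-exact rows where
those exist); their merit is «kernel, uniform in `U ≥ 0`, affine in `n`, ANY `t'`». Nothing here bears on superconductivity. Everything is
PROVED (kernel `decide` on integers + the bridge); no definition, no named fact, no sorry.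

## Mathlib / tree search

REUSED: `energyDensityTT'_ge_bathtub` (KinematicRows §3), `halfBathtub_le_of_cornerPairTable` + `halfBathtubPairTable128{,_length,_check₁,_check₂}`
(HalfBathtubCornerBound §9 / HalfBathtubPairTableRows), `MeasureTheory.volume_preserving_finTwoArrow`, `MeasureTheory.setIntegral_prod`,
`intervalIntegral.integral_comp_add_right`, `Function.Periodic.intervalIntegral_add_eq`, `Real.cos_add_pi`, `Real.cos_periodic`.
`lean search 'ge_affine_of_halfBathtub|FourCorner.*fermiSea|fermiSea.*cornerPairTable'`: nothing — no general-`t'` Fermi-sea floor was in the tree.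

## References

* E. H. Lieb, M. Loss, *Fluxes, Laplacians and Kasteleyn's theorem*, Duke Math. J. 71 (1993) 337, §8 Theorem 8.2 (the free Fermi sea
  minimises the kinetic energy at fixed particle number — the bathtub principle). [cite: LiebLoss1993, §8, Theorem 8.2]
* T. Hazra, N. Verma, M. Randeria, PRX 9 (2019) 031049, eqs. (2)–(6) (the half-bathtub integral). [cite: HazraVermaRanderia2019, eqs. (2)-(6)]
* W. Rudin, *Principles of Mathematical Analysis*, 3rd ed. (1976), Thm 6.12 (b),(c) (monotonicity of the integral), Thm 10.9/8.? (Fubini on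
  rectangles for continuous integrands). [cite: Rudin1976, Thm 6.12]
-/

noncomputable section

namespace Literature.MathematicalPhysics.QuantumLattice

open Real Set MeasureTheory ThermodynamicLimit Literature.Probability.LatticeModels

section FourCornerFermiSea

/-! ### §1 The bridge: a half-bathtub upper bound is a Fermi-sea floor -/

/-- The Brillouin zone of `ℤ²` is the preimage of the square under `p ↦ (p 0, p 1)` (copy of the private helper of
`HubbardOneBodyKinematicRows` §3). [folklore] -/
private theorem brillouin_two_eq_preimage_sq :
    brillouin 2 = (MeasurableEquiv.finTwoArrow : (Fin 2 → ℝ) ≃ᵐ ℝ × ℝ) ⁻¹' (Icc (-π) π ×ˢ Icc (-π) π) := by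
  ext p
  simp only [brillouin, Set.mem_pi, Set.mem_univ, true_implies, Set.mem_preimage, Set.mem_prod]
  exact ⟨fun h => ⟨h 0, h 1⟩, fun h i => by fin_cases i <;> [exact h.1; exact h.2]⟩

/-- A Brillouin-zone integral over `[-π,π]²` as an integral over the square in `ℝ × ℝ` (copy of the private helper of
`HubbardOneBodyKinematicRows` §3). [folklore] -/
private theorem integral_brillouin_two_eq_integral_sq (g : ℝ × ℝ → ℝ) :
    ∫ p in brillouin 2, g (p 0, p 1) = ∫ q in Icc (-π) π ×ˢ Icc (-π) π, g q := by
  have h := (volume_preserving_finTwoArrow ℝ).setIntegral_preimage_emb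
    (MeasurableEquiv.finTwoArrow : (Fin 2 → ℝ) ≃ᵐ ℝ × ℝ).measurableEmbedding g (Icc (-π) π ×ˢ Icc (-π) π)
  rw [← brillouin_two_eq_preimage_sq] at h
  exact h

/-- Fubini on the square for a continuous integrand, with interval integrals (copy of the private helper of
`HubbardOneBodyKinematicRows` §3). [folklore] -/
private theorem integral_sq_eq_iterated {g : ℝ × ℝ → ℝ} (hg : Continuous g) :
    ∫ q in Icc (-π) π ×ˢ Icc (-π) π, g q = ∫ x in (-π)..π, ∫ y in (-π)..π, g (x, y) := by
  have hππ : -π ≤ π := by linarith [Real.pi_pos]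
  rw [Measure.volume_eq_prod, setIntegral_prod g
      (hg.continuousOn.integrableOn_compact (isCompact_Icc.prod isCompact_Icc)),
    intervalIntegral.integral_of_le hππ, ← integral_Icc_eq_integral_Ioc]
  refine setIntegral_congr_fun measurableSet_Icc fun x _ => ?_
  rw [intervalIntegral.integral_of_le hππ, ← integral_Icc_eq_integral_Ioc]

/-- **Half-period shift**: `∫_{-π}^{π} g(-cos x) dx = ∫_{-π}^{π} g(cos x) dx` for every `g` (`-cos x = cos(x + π)`, translate by `π`,
and the `2π`-periodicity of `x ↦ g(cos x)`). [folklore] -/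
private theorem intervalIntegral_comp_neg_cos (g : ℝ → ℝ) :
    ∫ x in (-π)..π, g (-Real.cos x) = ∫ x in (-π)..π, g (Real.cos x) := by
  have h1 : (∫ x in (-π)..π, g (-Real.cos x)) = ∫ x in (-π)..π, (fun y => g (Real.cos y)) (x + π) := by
    refine intervalIntegral.integral_congr fun x _ => ?_
    simp only [Real.cos_add_pi]
  rw [h1, intervalIntegral.integral_comp_add_right (fun y => g (Real.cos y)) π]
  have hp : Function.Periodic (fun y => g (Real.cos y)) (2 * π) := fun y => by
    simp only [Real.cos_add_two_pi]
  have h2 := hp.intervalIntegral_add_eq 0 (-π)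
  rw [show (-π : ℝ) + π = 0 by ring, show (π : ℝ) + π = 0 + 2 * π by ring, h2]
  congr 1
  ring

/-- Pointwise: the corner-shifted Fermi-sea integrand at `t' = 2τ`, `μ = -2ν` is `-2×` the half-bathtub integrand at `(τ, ν)` evaluated at
the NEGATED cosines. [folklore] -/
private theorem min_band_eq_neg_two_mul_posPart (τ ν a b : ℝ) :
    min (2 * 1 * (a + b) - 4 * (2 * τ) * (a * b) - (-2 * ν)) 0 = -2 * max (-a + -b + 4 * τ * (-a * -b) - ν) 0 := by
  have e : 2 * 1 * (a + b) - 4 * (2 * τ) * (a * b) - (-2 * ν) = -2 * (-a + -b + 4 * τ * (-a * -b) - ν) := by ring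
  rw [e]
  rcases le_total (-a + -b + 4 * τ * (-a * -b) - ν) 0 with h | h
  · rw [max_eq_right h, min_eq_right (by nlinarith), mul_zero]
  · rw [max_eq_left h, min_eq_left (by nlinarith)]

/-- **The bridge (any `t'`): a half-bathtub UPPER bound is a Fermi-sea FLOOR.** For all real `τ, ν, B`, every `U ≥ 0` and every real density
`0 ≤ n < 2`: if `(4π²)⁻¹ ∫_{−π}^{π}∫_{−π}^{π} (cos x + cos y + 4τ cos x cos y − ν)⁺ dx dy ≤ B` then
`−2ν·n − 4B ≤ e(1, 2τ, U, n)`. (Bathtub principle `energyDensityTT'_ge_bathtub` at chemical potential `μ = −2ν` for the band with `t' = 2τ`: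
`min(ε − μ, 0) = −2·(…)⁺` at the negated cosines, Fubini on the square, and the half-period shift in each variable. No restriction on `t'`:
the four-corner table of `HalfBathtubCornerBound` §9 bounds `B` at every `t'`.) [cite: LiebLoss1993, §8, Theorem 8.2] -/
theorem energyDensityTT'_one_ge_affine_of_halfBathtub_le (τ ν : ℝ) {B : ℝ}
    (hB : (∫ y in (-π)..π, ∫ x in (-π)..π,
        max (Real.cos x + Real.cos y + 4 * τ * (Real.cos x * Real.cos y) - ν) 0) / (4 * π ^ 2) ≤ B)
    {U : ℝ} (hU : 0 ≤ U) {n : ℝ} (hn0 : 0 ≤ n) (hn2 : n < 2) :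
    -2 * ν * n - 4 * B ≤ energyDensityTT' 1 (2 * τ) U n := by
  have h0 := energyDensityTT'_ge_bathtub 1 (2 * τ) hU hn0 hn2 (-2 * ν)
  -- the Brillouin-zone integral as an iterated integral
  have hI : (∫ p in brillouin 2,
      min (2 * 1 * (Real.cos (p 0) + Real.cos (p 1)) - 4 * (2 * τ) * (Real.cos (p 0) * Real.cos (p 1)) - (-2 * ν)) 0) =
      ∫ x in (-π)..π, ∫ y in (-π)..π,
        min (2 * 1 * (Real.cos x + Real.cos y) - 4 * (2 * τ) * (Real.cos x * Real.cos y) - (-2 * ν)) 0 := by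
    have h := integral_brillouin_two_eq_integral_sq
      (fun q : ℝ × ℝ => min (2 * 1 * (Real.cos q.1 + Real.cos q.2) - 4 * (2 * τ) * (Real.cos q.1 * Real.cos q.2) - (-2 * ν)) 0)
    dsimp only at h
    rw [h, integral_sq_eq_iterated (by fun_prop)]
  -- pointwise rewrite and the two half-period shifts
  set F : ℝ → ℝ → ℝ := fun a b => max (a + b + 4 * τ * (a * b) - ν) 0 with hFdef
  have hpt : ∀ x y : ℝ, min (2 * 1 * (Real.cos x + Real.cos y) - 4 * (2 * τ) * (Real.cos x * Real.cos y) - (-2 * ν)) 0 =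
      -2 * F (-Real.cos x) (-Real.cos y) := by
    intro x y
    rw [min_band_eq_neg_two_mul_posPart, hFdef]
  -- inner shift (in `y`); the outer `-cos x` is flipped afterwards at the outer level
  have hinner' : ∀ x : ℝ, (∫ y in (-π)..π,
      min (2 * 1 * (Real.cos x + Real.cos y) - 4 * (2 * τ) * (Real.cos x * Real.cos y) - (-2 * ν)) 0) =
      -2 * ∫ y in (-π)..π, F (-Real.cos x) (Real.cos y) := by
    intro x
    simp_rw [hpt]
    rw [intervalIntegral.integral_const_mul, intervalIntegral_comp_neg_cos (fun b => F (-Real.cos x) b)]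
  have houter : (∫ x in (-π)..π, ∫ y in (-π)..π,
      min (2 * 1 * (Real.cos x + Real.cos y) - 4 * (2 * τ) * (Real.cos x * Real.cos y) - (-2 * ν)) 0) =
      -2 * ∫ x in (-π)..π, ∫ y in (-π)..π, F (Real.cos x) (Real.cos y) := by
    simp_rw [hinner']
    rw [intervalIntegral.integral_const_mul,
      intervalIntegral_comp_neg_cos (fun a => ∫ y in (-π)..π, F a (Real.cos y))]
  -- identify with the half-bathtub integral of the hypothesis (bound variables renamed, summands commuted)
  have hJ : (∫ x in (-π)..π, ∫ y in (-π)..π, F (Real.cos x) (Real.cos y)) =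
      ∫ y in (-π)..π, ∫ x in (-π)..π, max (Real.cos x + Real.cos y + 4 * τ * (Real.cos x * Real.cos y) - ν) 0 := by
    have hc : ∀ x y : ℝ, F (Real.cos x) (Real.cos y) =
        max (Real.cos y + Real.cos x + 4 * τ * (Real.cos y * Real.cos x) - ν) 0 := by
      intro x y
      show max (Real.cos x + Real.cos y + 4 * τ * (Real.cos x * Real.cos y) - ν) 0 = _
      rw [add_comm (Real.cos x) (Real.cos y), mul_comm (Real.cos x) (Real.cos y)]
    simp_rw [hc]
  have hπ : (0 : ℝ) < 4 * π ^ 2 := by positivity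
  have hJB : (∫ x in (-π)..π, ∫ y in (-π)..π, F (Real.cos x) (Real.cos y)) ≤ B * (4 * π ^ 2) := by
    rw [hJ]; rwa [div_le_iff₀ hπ] at hB
  have h2pi : (2 * Real.pi) ^ 2 = 4 * π ^ 2 := by ring
  rw [hI, houter, h2pi] at h0
  have hKJ : (4 * π ^ 2)⁻¹ * (∫ x in (-π)..π, ∫ y in (-π)..π, F (Real.cos x) (Real.cos y)) ≤ B := by
    rw [inv_mul_le_iff₀ hπ]; linarith
  linarith

/-! ### §2 The integer adapter (hubbard-tc-p1's four-corner pair table, any `t'`) -/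

/-- **Kernel Fermi-sea tangent rows at ANY `t'` from an integer four-corner table.** With the hypotheses of
`halfBathtub_le_of_cornerPairTable` verbatim — `τ = a/b`, `ν = c/E`, a list `P` of `M ≥ 1` integer (upper, reflected-lower) cosine pairs over
`D` passing the quarter-angle table check and the reflection check, the four-corner integer sum `≤ W`, and `W ≤ q·M²D²bE` — one gets, for every
`U ≥ 0` and every real `0 ≤ n < 2`, the affine floor `−2(c/E)·n − 4q ≤ e(1, 2a/b, U, n)` (a tangent row `S + μ n ≤ e` with `μ = −2c/E`,
`S = −4q`). [cite: LiebLoss1993, §8, Theorem 8.2] [cite: HazraVermaRanderia2019, eqs. (2)-(6)] -/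
theorem energyDensityTT'_one_ge_affine_of_cornerPairTable (a c : ℤ) (b E D M : ℕ) (W : ℤ) (q : ℚ)
    (P : List (ℤ × ℤ)) (hPM : P.length = M) (hM : 0 < M) (hb : 0 < b) (hE : 0 < E) (hD : 0 < D)
    (htab : ∀ i : ℕ, i < M → 2 * (2 * (1 - 2 * ((i : ℚ) * (392699 / 125000) / (8 * (M : ℚ)) -
      ((i : ℚ) * (392699 / 125000) / (8 * (M : ℚ))) ^ 3 / 6) ^ 2) ^ 2 - 1) ^ 2 - 1 ≤
      ((P.getD i (0, 0)).1 : ℚ) / (D : ℚ))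
    (hrefl : ∀ i : ℕ, i < M → (P.getD i (0, 0)).2 = -(P.getD (M - 1 - i) (0, 0)).1)
    (hW : (P.map fun x => (P.map fun y =>
        max (max (max ((x.1 + y.1) * D * b * E + 4 * a * x.1 * y.1 * E - c * (D : ℤ) ^ 2 * b)
            ((x.1 + y.2) * D * b * E + 4 * a * x.1 * y.2 * E - c * (D : ℤ) ^ 2 * b))
          (max ((x.2 + y.1) * D * b * E + 4 * a * x.2 * y.1 * E - c * (D : ℤ) ^ 2 * b)
            ((x.2 + y.2) * D * b * E + 4 * a * x.2 * y.2 * E - c * (D : ℤ) ^ 2 * b))) 0).sum).sum ≤ W)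
    (hq : (W : ℚ) ≤ q * ((M : ℚ) ^ 2 * (D : ℚ) ^ 2 * b * E))
    {U : ℝ} (hU : 0 ≤ U) {n : ℝ} (hn0 : 0 ≤ n) (hn2 : n < 2) :
    -2 * ((c : ℝ) / E) * n - 4 * ((q : ℚ) : ℝ) ≤ energyDensityTT' 1 (2 * ((a : ℝ) / b)) U n :=
  energyDensityTT'_one_ge_affine_of_halfBathtub_le ((a : ℝ) / b) ((c : ℝ) / E)
    (halfBathtub_le_of_cornerPairTable a c b E D M W q P hPM hM hb hE hD htab hrefl hW hq) hU hn0 hn2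

/-! ### §3 Rows: the positive-`t'` columns `27/50, 3/5, 13/20` touching at `n₀ = 9/10` (PH images of the Sr₀.₉La₀.₁CuO₂ object-E box) -/

set_option maxHeartbeats 2000000 in
set_option maxRecDepth 8192 in
/-- The four-corner integer sum behind the next row (`τ = t'/2 = 27/100`, level `ν = -μ/2 = -2665/8192`; one kernel `decide`). [cite: HazraVermaRanderia2019, eqs. (2)-(6)] -/
theorem fermiSeaRow4_tPrime_twentyseven_div_fifty_at_nine_div_ten_sum_le :
    (halfBathtubPairTable128.map fun x => (halfBathtubPairTable128.map fun y =>
        max (max (max ((x.1 + y.1) * ((1048576 : ℕ) : ℤ) * ((100 : ℕ) : ℤ) * ((8192 : ℕ) : ℤ) + 4 * (27 : ℤ) * x.1 * y.1 * ((8192 : ℕ) : ℤ) - (-2665 : ℤ) * ((1048576 : ℕ) : ℤ) ^ 2 * ((100 : ℕ) : ℤ))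
            ((x.1 + y.2) * ((1048576 : ℕ) : ℤ) * ((100 : ℕ) : ℤ) * ((8192 : ℕ) : ℤ) + 4 * (27 : ℤ) * x.1 * y.2 * ((8192 : ℕ) : ℤ) - (-2665 : ℤ) * ((1048576 : ℕ) : ℤ) ^ 2 * ((100 : ℕ) : ℤ)))
          (max ((x.2 + y.1) * ((1048576 : ℕ) : ℤ) * ((100 : ℕ) : ℤ) * ((8192 : ℕ) : ℤ) + 4 * (27 : ℤ) * x.2 * y.1 * ((8192 : ℕ) : ℤ) - (-2665 : ℤ) * ((1048576 : ℕ) : ℤ) ^ 2 * ((100 : ℕ) : ℤ))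
            ((x.2 + y.2) * ((1048576 : ℕ) : ℤ) * ((100 : ℕ) : ℤ) * ((8192 : ℕ) : ℤ) + 4 * (27 : ℤ) * x.2 * y.2 * ((8192 : ℕ) : ℤ) - (-2665 : ℤ) * ((1048576 : ℕ) : ℤ) ^ 2 * ((100 : ℕ) : ℤ)))) 0).sum).sum ≤ (9046460408128103022592 : ℤ) := by
  decide +kernel

set_option maxRecDepth 8192 in
/-- **Tangent Fermi-sea row at `t' = 27/50`, touching at `n₀ = 9/10`** (kernel four-corner table, `M = 128`, `μ = 2665/4096`):
`-2.4520480072 + (2665/4096)·n ≤ e(1, 27/50, U, n)` for every `U ≥ 0` and every real `0 ≤ n < 2`; at `n₀` the floor is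
`-1.8664767182`. As an LP row: `K₁(ω) + (27/50)·K₂(ω) ≥ -2.4520480072 + (2665/4096)·n` for every torus limit `ω` of unit density-`n`
vectors. [cite: LiebLoss1993, §8, Theorem 8.2] -/
theorem fermiSeaRow4_tPrime_twentyseven_div_fifty_at_nine_div_ten {U : ℝ} (hU : 0 ≤ U) {n : ℝ} (hn0 : 0 ≤ n) (hn2 : n < 2) :
    (-2.4520480072 : ℝ) + (2665 / 4096) * n ≤ energyDensityTT' 1 (27 / 50) U n := by
  have h := energyDensityTT'_one_ge_affine_of_cornerPairTable (27) (-2665) 100 8192 1048576 128 _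
    (3065060009 / 5000000000) halfBathtubPairTable128 halfBathtubPairTable128_length (by norm_num) (by norm_num) (by norm_num)
    (by norm_num) halfBathtubPairTable128_check₁ halfBathtubPairTable128_check₂ fermiSeaRow4_tPrime_twentyseven_div_fifty_at_nine_div_ten_sum_le (by norm_num) hU hn0 hn2
  have e1 : (2 : ℝ) * (((27 : ℤ) : ℝ) / ((100 : ℕ) : ℝ)) = 27 / 50 := by norm_num
  have e2 : (-2 : ℝ) * (((-2665 : ℤ) : ℝ) / ((8192 : ℕ) : ℝ)) * n - 4 * (((3065060009 / 5000000000 : ℚ)) : ℝ) = (-2.4520480072 : ℝ) + (2665 / 4096) * n := by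
    push_cast; ring
  rw [e1, e2] at h
  exact h

set_option maxHeartbeats 2000000 in
set_option maxRecDepth 8192 in
/-- The four-corner integer sum behind the next row (`τ = t'/2 = 3/10`, level `ν = -μ/2 = -2945/8192`; one kernel `decide`). [cite: HazraVermaRanderia2019, eqs. (2)-(6)] -/
theorem fermiSeaRow4_tPrime_three_div_five_at_nine_div_ten_sum_le :
    (halfBathtubPairTable128.map fun x => (halfBathtubPairTable128.map fun y =>
        max (max (max ((x.1 + y.1) * ((1048576 : ℕ) : ℤ) * ((10 : ℕ) : ℤ) * ((8192 : ℕ) : ℤ) + 4 * (3 : ℤ) * x.1 * y.1 * ((8192 : ℕ) : ℤ) - (-2945 : ℤ) * ((1048576 : ℕ) : ℤ) ^ 2 * ((10 : ℕ) : ℤ))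
            ((x.1 + y.2) * ((1048576 : ℕ) : ℤ) * ((10 : ℕ) : ℤ) * ((8192 : ℕ) : ℤ) + 4 * (3 : ℤ) * x.1 * y.2 * ((8192 : ℕ) : ℤ) - (-2945 : ℤ) * ((1048576 : ℕ) : ℤ) ^ 2 * ((10 : ℕ) : ℤ)))
          (max ((x.2 + y.1) * ((1048576 : ℕ) : ℤ) * ((10 : ℕ) : ℤ) * ((8192 : ℕ) : ℤ) + 4 * (3 : ℤ) * x.2 * y.1 * ((8192 : ℕ) : ℤ) - (-2945 : ℤ) * ((1048576 : ℕ) : ℤ) ^ 2 * ((10 : ℕ) : ℤ))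
            ((x.2 + y.2) * ((1048576 : ℕ) : ℤ) * ((10 : ℕ) : ℤ) * ((8192 : ℕ) : ℤ) + 4 * (3 : ℤ) * x.2 * y.2 * ((8192 : ℕ) : ℤ) - (-2945 : ℤ) * ((1048576 : ℕ) : ℤ) ^ 2 * ((10 : ℕ) : ℤ)))) 0).sum).sum ≤ (938675460610105606144 : ℤ) := by
  decide +kernel

set_option maxRecDepth 8192 in
/-- **Tangent Fermi-sea row at `t' = 3/5`, touching at `n₀ = 9/10`** (kernel four-corner table, `M = 128`, `μ = 2945/4096`):
`-2.5442849344 + (2945/4096)·n ≤ e(1, 3/5, U, n)` for every `U ≥ 0` and every real `0 ≤ n < 2`; at `n₀` the floor is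
`-1.8971902079`. As an LP row: `K₁(ω) + (3/5)·K₂(ω) ≥ -2.5442849344 + (2945/4096)·n` for every torus limit `ω` of unit density-`n`
vectors. [cite: LiebLoss1993, §8, Theorem 8.2] -/
theorem fermiSeaRow4_tPrime_three_div_five_at_nine_div_ten {U : ℝ} (hU : 0 ≤ U) {n : ℝ} (hn0 : 0 ≤ n) (hn2 : n < 2) :
    (-2.5442849344 : ℝ) + (2945 / 4096) * n ≤ energyDensityTT' 1 (3 / 5) U n := by
  have h := energyDensityTT'_one_ge_affine_of_cornerPairTable (3) (-2945) 10 8192 1048576 128 _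
    (397544521 / 625000000) halfBathtubPairTable128 halfBathtubPairTable128_length (by norm_num) (by norm_num) (by norm_num)
    (by norm_num) halfBathtubPairTable128_check₁ halfBathtubPairTable128_check₂ fermiSeaRow4_tPrime_three_div_five_at_nine_div_ten_sum_le (by norm_num) hU hn0 hn2
  have e1 : (2 : ℝ) * (((3 : ℤ) : ℝ) / ((10 : ℕ) : ℝ)) = 3 / 5 := by norm_num
  have e2 : (-2 : ℝ) * (((-2945 : ℤ) : ℝ) / ((8192 : ℕ) : ℝ)) * n - 4 * (((397544521 / 625000000 : ℚ)) : ℝ) = (-2.5442849344 : ℝ) + (2945 / 4096) * n := by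
    push_cast; ring
  rw [e1, e2] at h
  exact h

set_option maxHeartbeats 2000000 in
set_option maxRecDepth 8192 in
/-- The four-corner integer sum behind the next row (`τ = t'/2 = 13/40`, level `ν = -μ/2 = -3156/8192`; one kernel `decide`). [cite: HazraVermaRanderia2019, eqs. (2)-(6)] -/
theorem fermiSeaRow4_tPrime_thirteen_div_twenty_at_nine_div_ten_sum_le :
    (halfBathtubPairTable128.map fun x => (halfBathtubPairTable128.map fun y =>
        max (max (max ((x.1 + y.1) * ((1048576 : ℕ) : ℤ) * ((40 : ℕ) : ℤ) * ((8192 : ℕ) : ℤ) + 4 * (13 : ℤ) * x.1 * y.1 * ((8192 : ℕ) : ℤ) - (-3156 : ℤ) * ((1048576 : ℕ) : ℤ) ^ 2 * ((40 : ℕ) : ℤ))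
            ((x.1 + y.2) * ((1048576 : ℕ) : ℤ) * ((40 : ℕ) : ℤ) * ((8192 : ℕ) : ℤ) + 4 * (13 : ℤ) * x.1 * y.2 * ((8192 : ℕ) : ℤ) - (-3156 : ℤ) * ((1048576 : ℕ) : ℤ) ^ 2 * ((40 : ℕ) : ℤ)))
          (max ((x.2 + y.1) * ((1048576 : ℕ) : ℤ) * ((40 : ℕ) : ℤ) * ((8192 : ℕ) : ℤ) + 4 * (13 : ℤ) * x.2 * y.1 * ((8192 : ℕ) : ℤ) - (-3156 : ℤ) * ((1048576 : ℕ) : ℤ) ^ 2 * ((40 : ℕ) : ℤ))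
            ((x.2 + y.2) * ((1048576 : ℕ) : ℤ) * ((40 : ℕ) : ℤ) * ((8192 : ℕ) : ℤ) + 4 * (13 : ℤ) * x.2 * y.2 * ((8192 : ℕ) : ℤ) - (-3156 : ℤ) * ((1048576 : ℕ) : ℤ) ^ 2 * ((40 : ℕ) : ℤ)))) 0).sum).sum ≤ (3861899218019066118144 : ℤ) := by
  decide +kernel

set_option maxRecDepth 8192 in
/-- **Tangent Fermi-sea row at `t' = 13/20`, touching at `n₀ = 9/10`** (kernel four-corner table, `M = 128`, `μ = 789/1024`):
`-2.6169247016 + (789/1024)·n ≤ e(1, 13/20, U, n)` for every `U ≥ 0` and every real `0 ≤ n < 2`; at `n₀` the floor is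
`-1.9234676704`. As an LP row: `K₁(ω) + (13/20)·K₂(ω) ≥ -2.6169247016 + (789/1024)·n` for every torus limit `ω` of unit density-`n`
vectors. [cite: LiebLoss1993, §8, Theorem 8.2] -/
theorem fermiSeaRow4_tPrime_thirteen_div_twenty_at_nine_div_ten {U : ℝ} (hU : 0 ≤ U) {n : ℝ} (hn0 : 0 ≤ n) (hn2 : n < 2) :
    (-2.6169247016 : ℝ) + (789 / 1024) * n ≤ energyDensityTT' 1 (13 / 20) U n := by
  have h := energyDensityTT'_one_ge_affine_of_cornerPairTable (13) (-3156) 40 8192 1048576 128 _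
    (3271155877 / 5000000000) halfBathtubPairTable128 halfBathtubPairTable128_length (by norm_num) (by norm_num) (by norm_num)
    (by norm_num) halfBathtubPairTable128_check₁ halfBathtubPairTable128_check₂ fermiSeaRow4_tPrime_thirteen_div_twenty_at_nine_div_ten_sum_le (by norm_num) hU hn0 hn2
  have e1 : (2 : ℝ) * (((13 : ℤ) : ℝ) / ((40 : ℕ) : ℝ)) = 13 / 20 := by norm_num
  have e2 : (-2 : ℝ) * (((-3156 : ℤ) : ℝ) / ((8192 : ℕ) : ℝ)) * n - 4 * (((3271155877 / 5000000000 : ℚ)) : ℝ) = (-2.6169247016 : ℝ) + (789 / 1024) * n := by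
    push_cast; ring
  rw [e1, e2] at h
  exact h

end FourCornerFermiSea

end Literature.MathematicalPhysics.QuantumLattice

end
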